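import Summits.KontsevichZagierPeriods.KontsevichZagierPeriods.Theses.LiouvilleUnfolding
import Summits.KontsevichZagierPeriods.KontsevichZagierPeriods.Theorems.LiouvilleUnfoldingUnfoldedLogStokes

/-!
# UnfoldedLogPowerStokes — forward rung over `UnfoldedLogStokes` (G1 next-rung, seed g1-KontsevichZagierPeriods-2835)

FLOOR (proved): `Summit.KontsevichZagierPeriods.LiouvilleUnfolding.Engine.UnfoldedLogStokes_of :
LiouvilleUnfolding.UnfoldedLogStokes` — the unfolded logarithmic Stokes identity
`d/dt [H · log V] = H' log V + H V'/V` over a band, with `log V = ∫₁^V du/u` unfolded into one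
fibre variable (weight 1).

RUNG FAMILY `Rung k` (weight `k + 1`; ONE parameter moved: the log-weight): the same identity for
`d/dt [H · (log V)^(k+1)/(k+1)!]`, the power `(log V)^(k+1)/(k+1)!` being unfolded into the
`(k+1)`-simplex `{1 ≤ u_{k+1} ≤ … ≤ u₁ ≤ V}` with density `1/(u₁ ⋯ u_{k+1})`, and the partner term
`H V' (log V)^k/(k! V)` into the `k`-simplex. `Rung 0` is the floor VERBATIM up to the spelling of
the band (witness `Lines/UnfoldedLogPowerStokes_special.lean`); the deciding rung is
`UnfoldedLogPowerStokes := Rung 1` (weight 2); `Tower := ∀ k, Rung k`.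

STATUS OF THIS FILE. A forward-generator RUNG LINE registered on crux `stmt-KontsevichZagierPeriods-2837`
(`LiouvilleUnfolding.LogKernelConjecture`, = the summit by name, `logKernelConjecture_iff_summit`): it is a
POSITIVE-INSTANCE ENGINE of that crux ("positive instances may now be proved with logarithmic
antiderivatives", crux docstring) and does NOT conclude `LogKernelConjecture`; its composition theorem
`UnfoldedLogPowerStokes_of` concludes the RUNG. It honours the tenure note of the route (no
crux-ideate/plan/lead seat on 2837): the five `stub_*` below are rung lemmas, each strictly below the
floor's difficulty class, none a form of the crux.

WHERE THE FLOOR'S PROOF STOPS (and the replacing idea). The tree engine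
`KZ.unfoldedLogStokes_mem_relations` straightens `u = 1 + θ(V−1) =: S` and closes the cross term by a
pure-KZ Newton–Leibniz along `θ` with the ALGEBRAIC primitive `H V' θ/S` (`KZ.of_box₂_sub_of_mem_relations`,
`∂θ(θ/S) = 1/S²`). At weight 2 the same cross term carries the passive simplex variable and its
`θ`-primitive is `H V' (θ/S) log S` — logarithmic, so no rule-3 instance exists. NEW INGREDIENT
(`stub_reconnection`): that cross term together with the rational term `R₄'` is exactly the band side
of a SECOND weight-1 unfolded logarithmic Stokes identity, in the transverse direction `θ`, with
`G = H V' θ/S`, `W = S` — i.e. the floor applied to its own output ("height 2"); the `θ = 1` edge of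
that identity is `r₄`, the `θ = 0` edge is null.
-/

noncomputable section

open MeasureTheory Set
open Literature.NumberTheory.Transcendental Literature.ModelTheory.ExponentialFields

namespace Summit.KontsevichZagierPeriods.LiouvilleUnfolding.UnfoldedLogPowerStokes

/-- The base point of `w ∈ ℝ^{d+k}`: its first `d` coordinates (iterated `Fin.init`). -/
def basePt {d : ℕ} : (k : ℕ) → (Fin (d + k) → ℝ) → (Fin d → ℝ)
  | 0, w => w
  | k + 1, w => basePt k (Fin.init w)

/-- The product `u₁ ⋯ u_k` of the last `k` coordinates of `w ∈ ℝ^{d+k}` (`1` for `k = 0`). -/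
def fibProd {d : ℕ} : (k : ℕ) → (Fin (d + k) → ℝ) → ℝ
  | 0, _ => 1
  | k + 1, w => fibProd k (Fin.init w) * w (Fin.last (d + k))

/-- `top y` for `k = 0`, else the last coordinate. -/
def lastOrTop {d : ℕ} : (k : ℕ) → ((Fin d → ℝ) → ℝ) → (Fin (d + k) → ℝ) → ℝ
  | 0, top, y => top y
  | _ + 1, _, w => w (Fin.last _)

/-- The iterated simplex bundle over `S ⊆ ℝ^d` with top function `top`:
`{(y, u₁, …, u_k) | y ∈ S, 1 ≤ u_k ≤ u_{k-1} ≤ … ≤ u₁ ≤ top y}` (each new LAST coordinate lies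
between `1` and the previous one). Its fibre volume for the density `1/(u₁⋯u_k)` is
`(log (top y))^k / k!`. -/
def simplexOver {d : ℕ} : (k : ℕ) → Set (Fin d → ℝ) → ((Fin d → ℝ) → ℝ) → Set (Fin (d + k) → ℝ)
  | 0, S, _ => S
  | k + 1, S, top => {w | Fin.init w ∈ simplexOver k S top ∧ 1 ≤ w (Fin.last (d + k)) ∧
      w (Fin.last (d + k)) ≤ lastOrTop k top (Fin.init w)}

/-- `Rung k` — the unfolded logarithmic Stokes identity of WEIGHT `k + 1` (`Rung 0` = the floor
`LiouvilleUnfolding.UnfoldedLogStokes`). Over a `ℚ`-semialgebraic base `τ` with band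
`B = {(x,t) | a x ≤ t ≤ b x}`, for `H`, `V ≥ 1` semialgebraic on `B`, continuous on the closed
fibres and differentiable on the open ones (derivatives `H'`, `V'`):
`[simplex_{k+1}(V) over B, H'/(u₁⋯u_{k+1})] − [simplex_{k+1}(V(·,b·)) over τ, H(·,b·)/(u₁⋯u_{k+1})]
 + [simplex_{k+1}(V(·,a·)) over τ, H(·,a·)/(u₁⋯u_{k+1})] + [simplex_k(V) over B, H V'/(V u₁⋯u_k)]`
is a relation of the Kontsevich–Zagier calculus — Stokes for `d/dt [H (log V)^{k+1}/(k+1)!]` with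
every power of `log` unfolded. -/
def Rung (k : ℕ) : Prop :=
  ∀ (n : ℕ) (τ : Set (Fin n → ℝ)) (a b : (Fin n → ℝ) → ℝ) (H H' V V' : (Fin (n + 1) → ℝ) → ℝ)
    (r₁ : KZ.IntegralRep (n + 1 + (k + 1))) (r₂ r₃ : KZ.IntegralRep (n + (k + 1)))
    (r₄ : KZ.IntegralRep (n + 1 + k)),
    IsSemialgebraic ℚ τ → IsSemialgebraicFunOn ℚ τ a → IsSemialgebraicFunOn ℚ τ b →
    (∀ x ∈ τ, a x ≤ b x) →
    r₄.domain = simplexOver k (KZlog.band τ a b) V →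
    IsSemialgebraicFunOn ℚ (KZlog.band τ a b) H → IsSemialgebraicFunOn ℚ (KZlog.band τ a b) V →
    (∀ y ∈ KZlog.band τ a b, 1 ≤ V y) →
    (∀ x ∈ τ, ContinuousOn (fun t : ℝ => H (Fin.snoc x t)) (Icc (a x) (b x)) ∧
        ContinuousOn (fun t : ℝ => V (Fin.snoc x t)) (Icc (a x) (b x))) →
    (∀ x ∈ τ, ∀ t ∈ Ioo (a x) (b x),
        HasDerivAt (fun s : ℝ => H (Fin.snoc x s)) (H' (Fin.snoc x t)) t ∧
        HasDerivAt (fun s : ℝ => V (Fin.snoc x s)) (V' (Fin.snoc x t)) t) →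
    (∀ z ∈ simplexOver k (KZlog.band τ a b) V,
        a (Fin.init (basePt k z)) < basePt k z (Fin.last n) →
        basePt k z (Fin.last n) < b (Fin.init (basePt k z)) →
        r₄.integrand z = H (basePt k z) * V' (basePt k z) / (V (basePt k z) * fibProd k z)) →
    r₁.domain = simplexOver (k + 1) (KZlog.band τ a b) V →
    (∀ w ∈ r₁.domain,
        a (Fin.init (basePt (k + 1) w)) < basePt (k + 1) w (Fin.last n) →
        basePt (k + 1) w (Fin.last n) < b (Fin.init (basePt (k + 1) w)) →
        r₁.integrand w = H' (basePt (k + 1) w) / fibProd (k + 1) w) →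
    r₂.domain = simplexOver (k + 1) τ (fun x => V (Fin.snoc x (b x))) →
    (∀ z ∈ r₂.domain,
        r₂.integrand z = H (Fin.snoc (basePt (k + 1) z) (b (basePt (k + 1) z))) / fibProd (k + 1) z) →
    r₃.domain = simplexOver (k + 1) τ (fun x => V (Fin.snoc x (a x))) →
    (∀ z ∈ r₃.domain,
        r₃.integrand z = H (Fin.snoc (basePt (k + 1) z) (a (basePt (k + 1) z))) / fibProd (k + 1) z) →
    KZ.of r₁ - KZ.of r₂ + KZ.of r₃ + KZ.of r₄ ∈ KZ.relations

/-- The DECIDING RUNG (weight 2): Stokes for `d/dt [H (log V)²/2]`, `(log V)²/2` unfolded into the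
`2`-simplex `{1 ≤ u₂ ≤ u₁ ≤ V}` with density `1/(u₁u₂)`. -/
def UnfoldedLogPowerStokes : Prop := Rung 1

/-- The whole weight tower. -/
def Tower : Prop := ∀ k, Rung k

/-! ### F3 witness: `Rung 0` is the floor -/

/-- WITNESS (F3/BC5): the floor `UnfoldedLogStokes_of` is literally `Rung 0` — after unfolding the
recursive bookkeeping (`simplexOver 0 S _ = S`, `basePt 0 z = z`, `fibProd 0 z = 1`, one layer of
`simplexOver 1`) the only difference is that the floor spells the band `B` as `r₄.domain`. -/
theorem Rung_zero : Rung 0 := by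
  intro n τ a b H H' V V' r₁ r₂ r₃ r₄ hτ ha hb hab h4 hH hV hV1 hc hd h4i h1 h1i h2 h2i h3 h3i
  simp only [simplexOver, lastOrTop, basePt, fibProd, one_mul, mul_one] at h4 h4i h1 h1i h2 h2i h3 h3i
  rw [← h4] at hH hV hV1 h4i h1
  exact Summit.KontsevichZagierPeriods.LiouvilleUnfolding.Engine.UnfoldedLogStokes_of n τ a b H H' V V'
    r₁ r₂ r₃ r₄ hτ ha hb hab h4 hH hV hV1 hc hd h4i h1 h1i h2 h2i h3 h3i

example : Rung 0 := by simpa [Rung] using Rung_zero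

/-! ### The step weight 1 → weight 2: straightened data and auxiliary representations

Coordinates of the straightened band: `ỹ = (x, θ, t) ∈ ℝ^{n+2}` with `x ∈ τ`, `θ ∈ [0,1]`,
`t ∈ [a x, b x]`; `S = 1 + θ (V(x,t) − 1)` replaces the outer simplex variable `u₁ ∈ [1, V]`
(`du₁ = (V − 1) dθ`). -/

variable {n : ℕ}

/-- `τ̃ = τ × [0,1]` (the straightening parameter `θ` appended to the base). -/
def liftBase (τ : Set (Fin n → ℝ)) : Set (Fin (n + 1) → ℝ) :=
  KZlog.band τ (fun _ => 0) (fun _ => 1)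

/-- `B̃ = {(x, θ, t) | x ∈ τ, 0 ≤ θ ≤ 1, a x ≤ t ≤ b x}`. -/
def liftBand (τ : Set (Fin n → ℝ)) (a b : (Fin n → ℝ) → ℝ) : Set (Fin (n + 2) → ℝ) :=
  KZlog.band (liftBase τ) (fun x' => a (Fin.init x')) (fun x' => b (Fin.init x'))

/-- `(x, θ, t) ↦ (x, t)`. -/
def dropTheta (y' : Fin (n + 2) → ℝ) : Fin (n + 1) → ℝ :=
  Fin.snoc (Fin.init (Fin.init y')) (y' (Fin.last (n + 1)))

/-- `(x, θ, t) ↦ θ`. -/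
def theta (y' : Fin (n + 2) → ℝ) : ℝ := Fin.init y' (Fin.last n)

/-- `S(x, θ, t) = 1 + θ (V(x,t) − 1)`. -/
def strS (V : (Fin (n + 1) → ℝ) → ℝ) (y' : Fin (n + 2) → ℝ) : ℝ :=
  1 + theta y' * (V (dropTheta y') - 1)

/-- `H₁ = H (V − 1) / S` (the straightened integrand `H'` of `r₁` becomes `H₁'`, see below). -/
def strH (H V : (Fin (n + 1) → ℝ) → ℝ) (y' : Fin (n + 2) → ℝ) : ℝ :=
  H (dropTheta y') * (V (dropTheta y') - 1) / strS V y'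

/-- `∂H₁/∂t = H'(V − 1)/S + H V'/S²`. -/
def strH' (H H' V V' : (Fin (n + 1) → ℝ) → ℝ) (y' : Fin (n + 2) → ℝ) : ℝ :=
  H' (dropTheta y') * (V (dropTheta y') - 1) / strS V y' +
    H (dropTheta y') * V' (dropTheta y') / strS V y' ^ 2

/-- `∂S/∂t = θ V'`. -/
def strS' (V' : (Fin (n + 1) → ℝ) → ℝ) (y' : Fin (n + 2) → ℝ) : ℝ :=
  theta y' * V' (dropTheta y')

/-- The hypothesis block of the deciding rung `Rung 1`, bundled (fields = the hypotheses of
`Rung 1` verbatim, in order). -/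
structure Hyps (n : ℕ) (τ : Set (Fin n → ℝ)) (a b : (Fin n → ℝ) → ℝ)
    (H H' V V' : (Fin (n + 1) → ℝ) → ℝ) (r₁ : KZ.IntegralRep (n + 1 + (1 + 1)))
    (r₂ r₃ : KZ.IntegralRep (n + (1 + 1))) (r₄ : KZ.IntegralRep (n + 1 + 1)) : Prop where
  hτ : IsSemialgebraic ℚ τ
  ha : IsSemialgebraicFunOn ℚ τ a
  hb : IsSemialgebraicFunOn ℚ τ b
  hab : ∀ x ∈ τ, a x ≤ b x
  dom₄ : r₄.domain = simplexOver 1 (KZlog.band τ a b) V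
  hH : IsSemialgebraicFunOn ℚ (KZlog.band τ a b) H
  hV : IsSemialgebraicFunOn ℚ (KZlog.band τ a b) V
  hV1 : ∀ y ∈ KZlog.band τ a b, 1 ≤ V y
  cont : ∀ x ∈ τ, ContinuousOn (fun t : ℝ => H (Fin.snoc x t)) (Icc (a x) (b x)) ∧
    ContinuousOn (fun t : ℝ => V (Fin.snoc x t)) (Icc (a x) (b x))
  deriv : ∀ x ∈ τ, ∀ t ∈ Ioo (a x) (b x),
    HasDerivAt (fun s : ℝ => H (Fin.snoc x s)) (H' (Fin.snoc x t)) t ∧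
    HasDerivAt (fun s : ℝ => V (Fin.snoc x s)) (V' (Fin.snoc x t)) t
  int₄ : ∀ z ∈ simplexOver 1 (KZlog.band τ a b) V,
    a (Fin.init (basePt 1 z)) < basePt 1 z (Fin.last n) →
    basePt 1 z (Fin.last n) < b (Fin.init (basePt 1 z)) →
    r₄.integrand z = H (basePt 1 z) * V' (basePt 1 z) / (V (basePt 1 z) * fibProd 1 z)
  dom₁ : r₁.domain = simplexOver (1 + 1) (KZlog.band τ a b) V
  int₁ : ∀ w ∈ r₁.domain,
    a (Fin.init (basePt (1 + 1) w)) < basePt (1 + 1) w (Fin.last n) →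
    basePt (1 + 1) w (Fin.last n) < b (Fin.init (basePt (1 + 1) w)) →
    r₁.integrand w = H' (basePt (1 + 1) w) / fibProd (1 + 1) w
  dom₂ : r₂.domain = simplexOver (1 + 1) τ (fun x => V (Fin.snoc x (b x)))
  int₂ : ∀ z ∈ r₂.domain,
    r₂.integrand z = H (Fin.snoc (basePt (1 + 1) z) (b (basePt (1 + 1) z))) / fibProd (1 + 1) z
  dom₃ : r₃.domain = simplexOver (1 + 1) τ (fun x => V (Fin.snoc x (a x)))
  int₃ : ∀ z ∈ r₃.domain,
    r₃.integrand z = H (Fin.snoc (basePt (1 + 1) z) (a (basePt (1 + 1) z))) / fibProd (1 + 1) z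

/-- Shapes of the five AUXILIARY representations of the step (all over the straightened band
`B̃ ∋ (x, θ, t)`, fibre variable `u` last):
* `R₁' = [{(ỹ,u) : 1 ≤ u ≤ S}, H₁'/u]`, `R₄' = [B̃, H₁ S'/S]`, `R₂' , R₃' = [{(x,θ,u) : 1 ≤ u ≤ S(x,θ,e x)}, H₁(x,θ,e x)/u]`
  (`e = b, a`) — the four representations of the FLOOR instance for the straightened data
  `(τ̃, a ∘ init, b ∘ init, H₁, H₁', S, S')` in the `t`-direction;
* `R_B = [{(ỹ,u) : 1 ≤ u ≤ S}, H V'/(S² u)]` — the CROSS TERM (its `θ`-antiderivative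
  `H V' (θ/S) log S` is logarithmic: this is where the floor's own proof stops). -/
structure AuxShapes (n : ℕ) (τ : Set (Fin n → ℝ)) (a b : (Fin n → ℝ) → ℝ)
    (H H' V V' : (Fin (n + 1) → ℝ) → ℝ) (R₁' R_B : KZ.IntegralRep (n + 3))
    (R₂' R₃' R₄' : KZ.IntegralRep (n + 2)) : Prop where
  dom₄ : R₄'.domain = liftBand τ a b
  int₄ : ∀ y' ∈ liftBand τ a b, a (Fin.init (Fin.init y')) < y' (Fin.last (n + 1)) →
    y' (Fin.last (n + 1)) < b (Fin.init (Fin.init y')) →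
    R₄'.integrand y' = strH H V y' * strS' V' y' / strS V y'
  dom₁ : R₁'.domain = {w : Fin (n + 3) → ℝ | Fin.init w ∈ liftBand τ a b ∧ 1 ≤ w (Fin.last (n + 2)) ∧
    w (Fin.last (n + 2)) ≤ strS V (Fin.init w)}
  int₁ : ∀ w ∈ R₁'.domain, a (Fin.init (Fin.init (Fin.init w))) < Fin.init w (Fin.last (n + 1)) →
    Fin.init w (Fin.last (n + 1)) < b (Fin.init (Fin.init (Fin.init w))) →
    R₁'.integrand w = strH' H H' V V' (Fin.init w) / w (Fin.last (n + 2))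
  dom₂ : R₂'.domain = {z : Fin (n + 2) → ℝ | Fin.init z ∈ liftBase τ ∧ 1 ≤ z (Fin.last (n + 1)) ∧
    z (Fin.last (n + 1)) ≤ strS V (Fin.snoc (Fin.init z) (b (Fin.init (Fin.init z))))}
  int₂ : ∀ z ∈ R₂'.domain,
    R₂'.integrand z = strH H V (Fin.snoc (Fin.init z) (b (Fin.init (Fin.init z)))) / z (Fin.last (n + 1))
  dom₃ : R₃'.domain = {z : Fin (n + 2) → ℝ | Fin.init z ∈ liftBase τ ∧ 1 ≤ z (Fin.last (n + 1)) ∧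
    z (Fin.last (n + 1)) ≤ strS V (Fin.snoc (Fin.init z) (a (Fin.init (Fin.init z))))}
  int₃ : ∀ z ∈ R₃'.domain,
    R₃'.integrand z = strH H V (Fin.snoc (Fin.init z) (a (Fin.init (Fin.init z)))) / z (Fin.last (n + 1))
  domB : R_B.domain = {w : Fin (n + 3) → ℝ | Fin.init w ∈ liftBand τ a b ∧ 1 ≤ w (Fin.last (n + 2)) ∧
    w (Fin.last (n + 2)) ≤ strS V (Fin.init w)}
  intB : ∀ w ∈ R_B.domain, a (Fin.init (Fin.init (Fin.init w))) < Fin.init w (Fin.last (n + 1)) →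
    Fin.init w (Fin.last (n + 1)) < b (Fin.init (Fin.init (Fin.init w))) →
    R_B.integrand w = H (dropTheta (Fin.init w)) * V' (dropTheta (Fin.init w)) /
      (strS V (Fin.init w) ^ 2 * w (Fin.last (n + 2)))

/-! ### Registered stubs (the skeleton of the deciding rung) -/

/-- STUB E (aux reps exist; M): the five auxiliary representations exist — semialgebraicity of the
straightened shapes (BCR closure under `+ − × /` with `S ≥ 1`; the fibre derivatives extended by a
semialgebraic extension off the open band) and INTEGRABILITY, by Tonelli from that of `r₁, r₂, r₃,
r₄`: `∫₀¹ (V−1)/S · log S dθ = (log V)²/2`, `∫₀¹ log S/S² dθ = ((V−1) − log V)/((V−1)V) ≤ log V/V`,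
`∫₀¹ θ(V−1)/S² dθ = log V/(V−1) − 1/V ≤ log V/V`. -/
theorem stub_auxRepsExist (n : ℕ) (τ : Set (Fin n → ℝ)) (a b : (Fin n → ℝ) → ℝ)
    (H H' V V' : (Fin (n + 1) → ℝ) → ℝ) (r₁ : KZ.IntegralRep (n + 1 + (1 + 1)))
    (r₂ r₃ : KZ.IntegralRep (n + (1 + 1))) (r₄ : KZ.IntegralRep (n + 1 + 1))
    (h : Hyps n τ a b H H' V V' r₁ r₂ r₃ r₄) :
    ∃ (R₁' R_B : KZ.IntegralRep (n + 3)) (R₂' R₃' R₄' : KZ.IntegralRep (n + 2)),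
      AuxShapes n τ a b H H' V V' R₁' R_B R₂' R₃' R₄' := by
  sorry

/-- STUB A1 (bulk transport; M–L): `r₁ ∼ R₁' − R_B`. Straighten the outer simplex variable
`u₁ = S(x,θ,t)` of `r₁ = [{1 ≤ u₂ ≤ u₁ ≤ V}, H'/(u₁u₂)]`: one change of variables
`(x,θ,t,u) ↦ (x,t,S,u)` (Jacobian `V − 1`, injective on `{V > 1}`; the slice `{V = 1}` of `r₁` is
null and the corresponding part of the target has integrand `0`), giving `[{(ỹ,u): 1≤u≤S}, H'(V−1)/(S u)]`,
then integrand additivity `H₁'/u = H'(V−1)/(S u) + H V'/(S² u)` splits `R₁'` into that piece plus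
`R_B` (the junk values of `H', V'` on the closed edges `t = a x, b x` live on a null set:
`KZ.of_sub_of_mem_relations_of_eqOn`-type normalisation). Tools: `KZ.changeOfVariablesRel`,
`KZ.covLift` (KZLogCalculusProofs), `KZ.of_mem_relations_of_volume_eq_zero`. -/
theorem stub_bulkTransport (n : ℕ) (τ : Set (Fin n → ℝ)) (a b : (Fin n → ℝ) → ℝ)
    (H H' V V' : (Fin (n + 1) → ℝ) → ℝ) (r₁ : KZ.IntegralRep (n + 1 + (1 + 1)))
    (r₂ r₃ : KZ.IntegralRep (n + (1 + 1))) (r₄ : KZ.IntegralRep (n + 1 + 1))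
    (h : Hyps n τ a b H H' V V' r₁ r₂ r₃ r₄) (R₁' R_B : KZ.IntegralRep (n + 3))
    (R₂' R₃' R₄' : KZ.IntegralRep (n + 2)) (hX : AuxShapes n τ a b H H' V V' R₁' R_B R₂' R₃' R₄') :
    KZ.of r₁ - KZ.of R₁' + KZ.of R_B ∈ KZ.relations := by
  sorry

/-- STUB A2 (edge transport; M): `r₂ ∼ R₂'` and `r₃ ∼ R₃'` — the same straightening one dimension
down: `(x,θ,u) ↦ (x, S(x,θ,e x), u)` maps `[{1 ≤ u ≤ S(x,θ,e x)}, H(x,e x)(V(x,e x)−1)/(S u)]` onto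
`[{1 ≤ u₂ ≤ u₁ ≤ V(x,e x)}, H(x,e x)/(u₁u₂)]` (`e = b`, resp. `a`; `{V(x, e x) = 1}` null / zero). -/
theorem stub_edgeTransport (n : ℕ) (τ : Set (Fin n → ℝ)) (a b : (Fin n → ℝ) → ℝ)
    (H H' V V' : (Fin (n + 1) → ℝ) → ℝ) (r₁ : KZ.IntegralRep (n + 1 + (1 + 1)))
    (r₂ r₃ : KZ.IntegralRep (n + (1 + 1))) (r₄ : KZ.IntegralRep (n + 1 + 1))
    (h : Hyps n τ a b H H' V V' r₁ r₂ r₃ r₄) (R₁' R_B : KZ.IntegralRep (n + 3))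
    (R₂' R₃' R₄' : KZ.IntegralRep (n + 2)) (hX : AuxShapes n τ a b H H' V V' R₁' R_B R₂' R₃' R₄') :
    KZ.of r₂ - KZ.of R₂' ∈ KZ.relations ∧ KZ.of r₃ - KZ.of R₃' ∈ KZ.relations := by
  sorry

/-- STUB B (straightened Stokes = the FLOOR in the `t`-direction; M): the floor `Rung_zero`
applied to the straightened data `(n+1, τ̃, a ∘ init, b ∘ init, H₁, H₁', S, S')` with the reps
`R₁', R₂', R₃', R₄'`. Content = the side conditions: `τ̃` and `a ∘ init, b ∘ init` semialgebraic;
`H₁, S` semialgebraic on `B̃`, `S ≥ 1` (from `V ≥ 1`, `θ ∈ [0,1]`); continuity of `t ↦ H₁, S` on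
`[a x, b x]` and `HasDerivAt` with derivatives `H₁', S'` on the open interval (quotient/product rules,
`S ≥ 1`); then `exact Rung_zero (n+1) …` after `simp [simplexOver, basePt, fibProd, lastOrTop]`. -/
theorem stub_straightenedStokes (n : ℕ) (τ : Set (Fin n → ℝ)) (a b : (Fin n → ℝ) → ℝ)
    (H H' V V' : (Fin (n + 1) → ℝ) → ℝ) (r₁ : KZ.IntegralRep (n + 1 + (1 + 1)))
    (r₂ r₃ : KZ.IntegralRep (n + (1 + 1))) (r₄ : KZ.IntegralRep (n + 1 + 1))
    (h : Hyps n τ a b H H' V V' r₁ r₂ r₃ r₄) (R₁' R_B : KZ.IntegralRep (n + 3))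
    (R₂' R₃' R₄' : KZ.IntegralRep (n + 2)) (hX : AuxShapes n τ a b H H' V V' R₁' R_B R₂' R₃' R₄') :
    KZ.of R₁' - KZ.of R₂' + KZ.of R₃' + KZ.of R₄' ∈ KZ.relations := by
  sorry

/-- STUB Θ (reconnection = the FLOOR in the `θ`-direction; M — the NEW INGREDIENT): `R_B + R₄' ∼ r₄`.
Over the base `B ∋ (x,t)` with band variable `θ ∈ [0, 1]` take `G = H V' θ/S`, `W = S`
(`∂θ G = H V'/S²`, `G ∂θW/W = H V' θ (V−1)/S²`, `W ≥ 1`): the floor gives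
`[{1≤u≤S}, HV'/(S²u)] − [{1≤u≤W(·,1)=V}, G(·,1)/u = HV'/(V u)] + [{1≤u≤W(·,0)=1}, 0] + [B×[0,1], HV'θ(V−1)/S²] ∈ relations`,
i.e. `R_B − r₄ + (null) + R₄'` after the coordinate permutation `(x,t,θ,u) ↔ (x,θ,t,u)`
(`KZ.permRel ⊆ changeOfVariablesRel`, KZUnfolding) and replacing `V'` by its semialgebraic
extension off the open band (null-set normalisation, as in the floor's proof). -/
theorem stub_reconnection (n : ℕ) (τ : Set (Fin n → ℝ)) (a b : (Fin n → ℝ) → ℝ)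
    (H H' V V' : (Fin (n + 1) → ℝ) → ℝ) (r₁ : KZ.IntegralRep (n + 1 + (1 + 1)))
    (r₂ r₃ : KZ.IntegralRep (n + (1 + 1))) (r₄ : KZ.IntegralRep (n + 1 + 1))
    (h : Hyps n τ a b H H' V V' r₁ r₂ r₃ r₄) (R₁' R_B : KZ.IntegralRep (n + 3))
    (R₂' R₃' R₄' : KZ.IntegralRep (n + 2)) (hX : AuxShapes n τ a b H H' V V' R₁' R_B R₂' R₃' R₄') :
    KZ.of R_B + KZ.of R₄' - KZ.of r₄ ∈ KZ.relations := by
  sorry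

/-! ### Composition (kernel-checked, no sorry): the five stubs give the deciding rung -/

/-- `UnfoldedLogPowerStokes` (= `Rung 1`, weight 2) from the five stub STATEMENTS. Pure bookkeeping:
`r₁ − r₂ + r₃ + r₄ = (r₁ − R₁' + R_B) + (R₁' − R₂' + R₃' + R₄') − (R_B + R₄' − r₄) − (r₂ − R₂') + (r₃ − R₃')`. -/
theorem UnfoldedLogPowerStokes_of
    (hE : ∀ (n : ℕ) (τ : Set (Fin n → ℝ)) (a b : (Fin n → ℝ) → ℝ)
      (H H' V V' : (Fin (n + 1) → ℝ) → ℝ) (r₁ : KZ.IntegralRep (n + 1 + (1 + 1)))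
      (r₂ r₃ : KZ.IntegralRep (n + (1 + 1))) (r₄ : KZ.IntegralRep (n + 1 + 1)),
      Hyps n τ a b H H' V V' r₁ r₂ r₃ r₄ →
      ∃ (R₁' R_B : KZ.IntegralRep (n + 3)) (R₂' R₃' R₄' : KZ.IntegralRep (n + 2)),
        AuxShapes n τ a b H H' V V' R₁' R_B R₂' R₃' R₄')
    (hA1 : ∀ (n : ℕ) (τ : Set (Fin n → ℝ)) (a b : (Fin n → ℝ) → ℝ)
      (H H' V V' : (Fin (n + 1) → ℝ) → ℝ) (r₁ : KZ.IntegralRep (n + 1 + (1 + 1)))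
      (r₂ r₃ : KZ.IntegralRep (n + (1 + 1))) (r₄ : KZ.IntegralRep (n + 1 + 1)),
      Hyps n τ a b H H' V V' r₁ r₂ r₃ r₄ → ∀ (R₁' R_B : KZ.IntegralRep (n + 3))
      (R₂' R₃' R₄' : KZ.IntegralRep (n + 2)), AuxShapes n τ a b H H' V V' R₁' R_B R₂' R₃' R₄' →
      KZ.of r₁ - KZ.of R₁' + KZ.of R_B ∈ KZ.relations)
    (hA2 : ∀ (n : ℕ) (τ : Set (Fin n → ℝ)) (a b : (Fin n → ℝ) → ℝ)
      (H H' V V' : (Fin (n + 1) → ℝ) → ℝ) (r₁ : KZ.IntegralRep (n + 1 + (1 + 1)))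
      (r₂ r₃ : KZ.IntegralRep (n + (1 + 1))) (r₄ : KZ.IntegralRep (n + 1 + 1)),
      Hyps n τ a b H H' V V' r₁ r₂ r₃ r₄ → ∀ (R₁' R_B : KZ.IntegralRep (n + 3))
      (R₂' R₃' R₄' : KZ.IntegralRep (n + 2)), AuxShapes n τ a b H H' V V' R₁' R_B R₂' R₃' R₄' →
      KZ.of r₂ - KZ.of R₂' ∈ KZ.relations ∧ KZ.of r₃ - KZ.of R₃' ∈ KZ.relations)
    (hB : ∀ (n : ℕ) (τ : Set (Fin n → ℝ)) (a b : (Fin n → ℝ) → ℝ)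
      (H H' V V' : (Fin (n + 1) → ℝ) → ℝ) (r₁ : KZ.IntegralRep (n + 1 + (1 + 1)))
      (r₂ r₃ : KZ.IntegralRep (n + (1 + 1))) (r₄ : KZ.IntegralRep (n + 1 + 1)),
      Hyps n τ a b H H' V V' r₁ r₂ r₃ r₄ → ∀ (R₁' R_B : KZ.IntegralRep (n + 3))
      (R₂' R₃' R₄' : KZ.IntegralRep (n + 2)), AuxShapes n τ a b H H' V V' R₁' R_B R₂' R₃' R₄' →
      KZ.of R₁' - KZ.of R₂' + KZ.of R₃' + KZ.of R₄' ∈ KZ.relations)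
    (hΘ : ∀ (n : ℕ) (τ : Set (Fin n → ℝ)) (a b : (Fin n → ℝ) → ℝ)
      (H H' V V' : (Fin (n + 1) → ℝ) → ℝ) (r₁ : KZ.IntegralRep (n + 1 + (1 + 1)))
      (r₂ r₃ : KZ.IntegralRep (n + (1 + 1))) (r₄ : KZ.IntegralRep (n + 1 + 1)),
      Hyps n τ a b H H' V V' r₁ r₂ r₃ r₄ → ∀ (R₁' R_B : KZ.IntegralRep (n + 3))
      (R₂' R₃' R₄' : KZ.IntegralRep (n + 2)), AuxShapes n τ a b H H' V V' R₁' R_B R₂' R₃' R₄' →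
      KZ.of R_B + KZ.of R₄' - KZ.of r₄ ∈ KZ.relations) :
    UnfoldedLogPowerStokes := by
  intro n τ a b H H' V V' r₁ r₂ r₃ r₄ hτ ha hb hab d4 hH hV hV1 hc hd i4 d1 i1 d2 i2 d3 i3
  have h : Hyps n τ a b H H' V V' r₁ r₂ r₃ r₄ :=
    ⟨hτ, ha, hb, hab, d4, hH, hV, hV1, hc, hd, i4, d1, i1, d2, i2, d3, i3⟩
  obtain ⟨R₁', R_B, R₂', R₃', R₄', hX⟩ := hE n τ a b H H' V V' r₁ r₂ r₃ r₄ h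
  have p₁ := hA1 n τ a b H H' V V' r₁ r₂ r₃ r₄ h R₁' R_B R₂' R₃' R₄' hX
  obtain ⟨p₂, p₃⟩ := hA2 n τ a b H H' V V' r₁ r₂ r₃ r₄ h R₁' R_B R₂' R₃' R₄' hX
  have p₄ := hB n τ a b H H' V V' r₁ r₂ r₃ r₄ h R₁' R_B R₂' R₃' R₄' hX
  have p₅ := hΘ n τ a b H H' V V' r₁ r₂ r₃ r₄ h R₁' R_B R₂' R₃' R₄' hX
  have e : KZ.of r₁ - KZ.of r₂ + KZ.of r₃ + KZ.of r₄ =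
      (KZ.of r₁ - KZ.of R₁' + KZ.of R_B) + (KZ.of R₁' - KZ.of R₂' + KZ.of R₃' + KZ.of R₄') -
        (KZ.of R_B + KZ.of R₄' - KZ.of r₄) - (KZ.of r₂ - KZ.of R₂') + (KZ.of r₃ - KZ.of R₃') := by
    abel
  rw [e]
  exact add_mem (sub_mem (sub_mem (add_mem p₁ p₄) p₅) p₂) p₃

/-- Consistency check: the registered stubs have exactly the statements consumed above. -/
theorem UnfoldedLogPowerStokes_of_stubs : UnfoldedLogPowerStokes :=
  UnfoldedLogPowerStokes_of stub_auxRepsExist stub_bulkTransport stub_edgeTransport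
    stub_straightenedStokes stub_reconnection

/-- The ladder above the deciding rung: the tower follows from the floor and a uniform step
(same two-direction mechanism at every weight; not registered as a stub — it is the NEXT rung). -/
theorem Tower_of (step : ∀ k, Rung k → Rung (k + 1)) : Tower := by
  intro k
  induction k with
  | zero => exact Rung_zero
  | succ k ih => exact step k ih

end Summit.KontsevichZagierPeriods.LiouvilleUnfolding.UnfoldedLogPowerStokes
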